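import Mathlib
import Literature.Analysis.FluidPDE.TypeIAncientMild
import Literature.Analysis.FluidPDE.HyperbolicDSSOrbit
import Literature.Analysis.FluidPDE.NormalisedPressure
import Literature.Analysis.FluidPDE.SelfSimilar
import Literature.Analysis.FluidPDE.ClassicalSolution

/-!
# Sketch — crux stmt-NavierStokesRegularity-1217 (`Target` / `NoTypeIBlowup`), crux-ideate round 1,
ideator 2: first lemmas of idea card `radial-reynolds-scalar` (the head-flux channel).

Backward similarity (Leray) variables: `U = lerayOrbit u`, `U s y = e^{-s/2} u (−e^{−s}) (e^{−s/2} y)`,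
Gaussian weight `G y = exp (−‖y‖²/4)`, head `H = ‖U‖²/2 + P` with `P = normalisedPressure (U s)`,
radial Reynolds scalar `ψ̃ = ⟪y, U s y⟫` (= `⟪x, u t x⟫`, scale invariant).

Exact identity behind everything (OU self-adjointness kills the linear mismatch):
  d/ds ½∫‖U‖²G = −∫‖∇U‖²G − ½∫‖U‖²G − ½∫ H ψ̃ G.
-/

open scoped InnerProductSpace
open Laplacian MeasureTheory Set

namespace Summit.NavierStokesRegularity.NavierStokesRegularity.Cruxes.Target.RadialReynoldsScalar

local notation "ℝ³" => EuclideanSpace ℝ (Fin 3)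

/-- FL2 (operative first lemma, the lever): **Gaussian head-flux criterion.** A Type-I ancient
mild solution (Oseen gauge, temporal rate `C`, space–time envelope `C`) whose Gaussian-weighted
radial head flux `∫ (½‖U‖² + P) ⟪y, U⟫ e^{−‖y‖²/4} dy` is non-negative at every similarity time
is trivial: the Gaussian energy then obeys `E' ≤ −E` on the whole line, hence vanishes. -/
def GaussianHeadFluxCriterion : Prop :=
  ∀ (C : ℝ) (u : ℝ → ℝ³ → ℝ³), Literature.Analysis.FluidPDE.IsTypeIAncientMild C u →
    Literature.Analysis.FluidPDE.HasTypeIDecay C u →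
    (∀ s : ℝ, 0 ≤ ∫ y, (‖Literature.Analysis.FluidPDE.lerayOrbit u s y‖ ^ 2 / 2 +
        Literature.Analysis.FluidPDE.normalisedPressure
          (Literature.Analysis.FluidPDE.lerayOrbit u s) y) *
        ⟪y, Literature.Analysis.FluidPDE.lerayOrbit u s y⟫_ℝ * Real.exp (-‖y‖ ^ 2 / 4)) →
    ∀ t < 0, ∀ x, u t x = 0

/-- FL1 (free instance / calibration): **toroidal Type-I Liouville.** If the flow is tangent to
every sphere about the singular point (`⟪x, u t x⟫ = 0`), the head-flux channel is identically
closed and FL2 applies with equality. Symmetry-free; not covered by KNSS (2-D, axisymmetric). -/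
def ToroidalTypeILiouville : Prop :=
  ∀ (C : ℝ) (u : ℝ → ℝ³ → ℝ³), Literature.Analysis.FluidPDE.IsTypeIAncientMild C u →
    Literature.Analysis.FluidPDE.HasTypeIDecay C u →
    (∀ t < 0, ∀ x, ⟪x, u t x⟫_ℝ = 0) → ∀ t < 0, ∀ x, u t x = 0

/-- FL3 (prong (b), provable-now calculus): **transport equation of the radial Reynolds scalar**
`ψ(t,x) = ⟪x, u(t,x)⟫` along any classical unforced Navier–Stokes solution:
`∂ₜψ + u·∇ψ − νΔψ = ‖u‖² − ⟪x, ∇p⟫` (the viscous cross term `2ν div u` vanishes). -/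
def RadialReynoldsTransport : Prop :=
  ∀ (S : Set ℝ) (ν : ℝ) (u : ℝ → ℝ³ → ℝ³) (p : ℝ → ℝ³ → ℝ),
    Literature.Analysis.FluidPDE.IsClassicalNSSolutionOn S ν 0 u p → ∀ t ∈ S, ∀ x,
      Literature.Analysis.FluidPDE.timeDerivWithin S (fun s z => ⟪z, u s z⟫_ℝ) t x
        + ⟪u t x, gradient (fun z => ⟪z, u t z⟫_ℝ) x⟫_ℝ
        - ν * (Δ (fun z => ⟪z, u t z⟫_ℝ)) x
      = ‖u t x‖ ^ 2 - ⟪x, gradient (p t) x⟫_ℝ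

/-- FL4 (sanity, provable now): under the space–time Type-I envelope the radial Reynolds scalar is
bounded by the Type-I constant: `|⟪x, u t x⟫| ≤ C` (since `‖x‖ ≤ ‖x‖ + √(−t)`). -/
def RadialReynoldsBounded : Prop :=
  ∀ (C : ℝ) (u : ℝ → ℝ³ → ℝ³), Literature.Analysis.FluidPDE.HasTypeIDecay C u →
    ∀ t < 0, ∀ x, |⟪x, u t x⟫_ℝ| ≤ C

/-- FL4 is elementary: Cauchy–Schwarz and `‖x‖ / (‖x‖ + √(−t)) ≤ 1`. -/
theorem radialReynoldsBounded_holds : RadialReynoldsBounded := by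
  intro C u hu t ht x
  have hden : 0 < ‖x‖ + Real.sqrt (-t) :=
    add_pos_of_nonneg_of_pos (norm_nonneg _) (Real.sqrt_pos.2 (by linarith))
  have hC : 0 ≤ C := by
    have h0 := hu t ht 0
    have : (0:ℝ) ≤ C / (‖(0:ℝ³)‖ + Real.sqrt (-t)) := (norm_nonneg _).trans h0
    rw [norm_zero, zero_add] at this
    exact (div_nonneg_iff.1 this).elim (fun h => h.1) (fun h => by
      have := Real.sqrt_pos.2 (show (0:ℝ) < -t by linarith); linarith [h.2])
  calc |⟪x, u t x⟫_ℝ| ≤ ‖x‖ * ‖u t x‖ := abs_real_inner_le_norm x (u t x)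
    _ ≤ ‖x‖ * (C / (‖x‖ + Real.sqrt (-t))) := by gcongr; exact hu t ht x
    _ = C * (‖x‖ / (‖x‖ + Real.sqrt (-t))) := by ring
    _ ≤ C * 1 := by
        gcongr
        rw [div_le_one hden]
        exact le_add_of_nonneg_right (Real.sqrt_nonneg _)
    _ = C := mul_one C

end Summit.NavierStokesRegularity.NavierStokesRegularity.Cruxes.Target.RadialReynoldsScalar
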